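import Summits.BirchSwinnertonDyer.BirchSwinnertonDyer.Theorems.UniversalToricDescentTwinSplitIMCAtThreeOfThreeFrames
import HarnessLib

/-!
# Route `UniversalToricDescent`, crux `TwinSplitIMCAtThreeGoodSS` (stmt-BirchSwinnertonDyer-20695), line `threeframes`:
# the registered stub `stub_howardFrameSS` (the `⊇`-half / Howard frame at a GOOD-SUPERSINGULAR twin at `p = 3`)
# split by the value of `a₃` — kernel-certified reshape option for the steward

Seat `bsd-wall-utd-p2` g5 (D-0131 (3) MIDDLE tier, strategy «twin-split IMC at 3, ⊇-half only: Howard 2004 / BCK21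
transfer pushed to `p = 3`»; memo `HOME/bsd-wall/bsd-wall-utd-p2/SUPSET-AT3-v8.md`). Sorry-free, definition-free, closes
nothing: `stub_howardFrameSS` VERBATIM (skeleton v3, sha16 155dcab4167cf6ab) follows from its two restrictions
* `HowardFrameSS[a₃ = 0]`  — hypothesis `h0`:  the stub with the extra binder `W′.frobeniusTrace 3 = 0`;
* `HowardFrameSS[a₃ ≠ 0]`  — hypothesis `hne`: the stub with the extra binder `W′.frobeniusTrace 3 ≠ 0`
  (under `GoodSS W′ 3` this is `a₃ = ±3` by the Hasse bound, which is NOT needed for the split);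
by excluded middle on `W′.frobeniusTrace 3 = 0`. WHY the split is the honest STUCK list (memo v8 §1–§2, first-hand
reads): the `a₃ = 0` half is PORT-SHAPED — the refereed mechanism Castella–Wan, Math. Ann. 389 (2024) §5 (± Heegner
classes need `a_p = 0`, arXiv:1607.02019 p. 18 «(so a_p = 0)», «since a_p = 0») + §6.1 first half of the proof of Thm. 6.1
(`Char(𝔛_𝔭) ⊇ (𝓛^BDP)²`, derived before `p ≥ 5, N⁻ ≠ 1` are used) — displayed at `p > 3` only; the `a₃ ≠ 0` half has
NO ± theory and its only mechanism is the PREPRINT Castella–Çiperiani–Skinner–Sprung 2018 (♯/♭ signed Heegner classes,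
arXiv:1804.10993 §§2–5; tree OPEN claim p545192). `--supports stmt-BirchSwinnertonDyer-20695`. Beyond-print theorem: NO.
-/

noncomputable section

open scoped Classical

set_option linter.dupNamespace false
set_option autoImplicit false

namespace Summit.BirchSwinnertonDyer.BirchSwinnertonDyer.Theorems.UniversalToricDescentTwinSplit.HowardSplitByA3

open PowerSeries WeierstrassCurve NumberField IsDedekindDomain Field
  Literature.NumberTheory.EllipticCurves
  Literature.NumberTheory.EllipticCurves.ModularForms
  Literature.NumberTheory.EllipticCurves.Rank1Residual
  Summit.BirchSwinnertonDyer.Rank1Residual.X11b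
  Summit.BirchSwinnertonDyer.Rank1Residual.X11b.Halves
  Summit.BirchSwinnertonDyer.BirchSwinnertonDyer.Theorems.SchneiderFree

/-- **`stub_howardFrameSS` ⟸ its `a₃ = 0` restriction ∧ its `a₃ ≠ 0` restriction** (excluded middle on
`W′.frobeniusTrace 3 = 0`; the conclusion is the registered stub text VERBATIM: one BDP frame `(Ω_K ≠ 0, Ω_p ≠ 0, L)` of
`f_{W′}` at `(ι′, 𝔭)` with `L ∈ Ch_Λ(X_ac(W′_K) strict at 𝔭′)·R₀⟦T⟧`). The `a₃ = 0` hypothesis `h0` is the port-shaped half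
(Castella–Wan 2024 §5–§6.1 mechanism, printed at `p > 3`), the `a₃ ≠ 0` hypothesis `hne` the preprint-only half (CÇSS 2018).
[cite: CastellaWan2023, §5 p. 18 and §6.1 proof of Thm. 6.1 (arXiv:1607.02019)]
[cite: CastellaCiperianiSkinnerSprung2018, §1.2 pp. 4–6 (arXiv:1804.10993v2)] -/
theorem stub_howardFrameSS_of_apZero_of_apNeZero
    (h0 : ∀ (W' : WeierstrassCurve ℚ) [W'.IsElliptic] [W'.IsGloballyMinimal] (N' : ℕ) [NeZero N']
      (K : Type) [Field K] [NumberField K] (Dt' : ModularParametrizationData W' N'),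
      GoodSS W' 3 → W'.frobeniusTrace 3 = 0 → W'.HasSurjectiveModNGaloisRep 3 → W'.conductorNorm ℤ = N' →
      IsImaginaryQuadratic K → SatisfiesHeegnerHypothesis N' K → Odd (NumberField.discr K) →
      ∀ (κ : ZpExtension K 3), κ.IsAnticyclotomic → ∀ (γ : absoluteGaloisGroup K) [Fact (κ.IsTopGenerator γ)]
        (𝔭 : HeightOneSpectrum (𝓞 K)), ((3 : ℕ) : 𝓞 K) ∈ 𝔭.asIdeal →
        𝔭.asIdeal.ramificationIdx (𝓞 ℚ) = 1 → 𝔭.asIdeal.inertiaDeg (𝓞 ℚ) = 1 →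
        ∀ (𝔭' : HeightOneSpectrum (𝓞 K)), ((3 : ℕ) : 𝓞 K) ∈ 𝔭'.asIdeal → 𝔭' ≠ 𝔭 →
        ∀ (ι' : PadicAlgCl 3 ≃+* ℂ), BranchInducesPrime 3 ι' 𝔭 →
        ∃ (ΩK : ℂ) (Ωp : ℂ_[3]) (L : UnrSeries 3), ΩK ≠ 0 ∧ Ωp ≠ 0 ∧
          IsBDPLFunction ι' 𝔭 κ γ Dt'.f ΩK Ωp L ∧
          L ∈ (AcSelmer.XAc.charIdeal (W'.baseChange K) 3 κ 𝔭' ∅ γ).map (PowerSeries.map (toUnr 3)))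
    (hne : ∀ (W' : WeierstrassCurve ℚ) [W'.IsElliptic] [W'.IsGloballyMinimal] (N' : ℕ) [NeZero N']
      (K : Type) [Field K] [NumberField K] (Dt' : ModularParametrizationData W' N'),
      GoodSS W' 3 → W'.frobeniusTrace 3 ≠ 0 → W'.HasSurjectiveModNGaloisRep 3 → W'.conductorNorm ℤ = N' →
      IsImaginaryQuadratic K → SatisfiesHeegnerHypothesis N' K → Odd (NumberField.discr K) →
      ∀ (κ : ZpExtension K 3), κ.IsAnticyclotomic → ∀ (γ : absoluteGaloisGroup K) [Fact (κ.IsTopGenerator γ)]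
        (𝔭 : HeightOneSpectrum (𝓞 K)), ((3 : ℕ) : 𝓞 K) ∈ 𝔭.asIdeal →
        𝔭.asIdeal.ramificationIdx (𝓞 ℚ) = 1 → 𝔭.asIdeal.inertiaDeg (𝓞 ℚ) = 1 →
        ∀ (𝔭' : HeightOneSpectrum (𝓞 K)), ((3 : ℕ) : 𝓞 K) ∈ 𝔭'.asIdeal → 𝔭' ≠ 𝔭 →
        ∀ (ι' : PadicAlgCl 3 ≃+* ℂ), BranchInducesPrime 3 ι' 𝔭 →
        ∃ (ΩK : ℂ) (Ωp : ℂ_[3]) (L : UnrSeries 3), ΩK ≠ 0 ∧ Ωp ≠ 0 ∧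
          IsBDPLFunction ι' 𝔭 κ γ Dt'.f ΩK Ωp L ∧
          L ∈ (AcSelmer.XAc.charIdeal (W'.baseChange K) 3 κ 𝔭' ∅ γ).map (PowerSeries.map (toUnr 3))) :
    ∀ (W' : WeierstrassCurve ℚ) [W'.IsElliptic] [W'.IsGloballyMinimal] (N' : ℕ) [NeZero N']
      (K : Type) [Field K] [NumberField K] (Dt' : ModularParametrizationData W' N'),
      GoodSS W' 3 → W'.HasSurjectiveModNGaloisRep 3 → W'.conductorNorm ℤ = N' → IsImaginaryQuadratic K →
      SatisfiesHeegnerHypothesis N' K → Odd (NumberField.discr K) →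
      ∀ (κ : ZpExtension K 3), κ.IsAnticyclotomic → ∀ (γ : absoluteGaloisGroup K) [Fact (κ.IsTopGenerator γ)]
        (𝔭 : HeightOneSpectrum (𝓞 K)), ((3 : ℕ) : 𝓞 K) ∈ 𝔭.asIdeal →
        𝔭.asIdeal.ramificationIdx (𝓞 ℚ) = 1 → 𝔭.asIdeal.inertiaDeg (𝓞 ℚ) = 1 →
        ∀ (𝔭' : HeightOneSpectrum (𝓞 K)), ((3 : ℕ) : 𝓞 K) ∈ 𝔭'.asIdeal → 𝔭' ≠ 𝔭 →
        ∀ (ι' : PadicAlgCl 3 ≃+* ℂ), BranchInducesPrime 3 ι' 𝔭 →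
        ∃ (ΩK : ℂ) (Ωp : ℂ_[3]) (L : UnrSeries 3), ΩK ≠ 0 ∧ Ωp ≠ 0 ∧
          IsBDPLFunction ι' 𝔭 κ γ Dt'.f ΩK Ωp L ∧
          L ∈ (AcSelmer.XAc.charIdeal (W'.baseChange K) 3 κ 𝔭' ∅ γ).map (PowerSeries.map (toUnr 3)) := by
  intro W' _ _ N' _ K _ _ Dt' hss hsurj hN' hK hH hodd κ hκ γ _ 𝔭 h𝔭 he hf 𝔭' h𝔭' hne' ι' hι'
  by_cases h3 : W'.frobeniusTrace 3 = 0
  · exact h0 W' N' K Dt' hss h3 hsurj hN' hK hH hodd κ hκ γ 𝔭 h𝔭 he hf 𝔭' h𝔭' hne' ι' hι'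
  · exact hne W' N' K Dt' hss h3 hsurj hN' hK hH hodd κ hκ γ 𝔭 h𝔭 he hf 𝔭' h𝔭' hne' ι' hι'

/-- Under `GoodSS W′ 3` the two cases are `a₃ = 0` and `3 ∣ a₃ ≠ 0`; the second unfolds to `(3 : ℤ) ∣ W′.frobeniusTrace 3 ∧
W′.frobeniusTrace 3 ≠ 0` (by the Hasse bound this is `a₃ = ±3`, not used). Bookkeeping for the steward's census: the
`a₃ ≠ 0` half is the one with no ± theory. [cite: CastellaCiperianiSkinnerSprung2018, §1.1 p. 3 (arXiv:1804.10993v2)] -/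
theorem goodSS_apNeZero_iff (W' : WeierstrassCurve ℚ) [W'.IsGloballyMinimal] :
    (GoodSS W' 3 ∧ W'.frobeniusTrace 3 ≠ 0) ↔
      (W'.HasGoodReductionAtPrime 3 ∧ (3 : ℤ) ∣ W'.frobeniusTrace 3 ∧ W'.frobeniusTrace 3 ≠ 0) := by
  simp only [GoodSS, Nat.cast_ofNat, and_assoc]

end Summit.BirchSwinnertonDyer.BirchSwinnertonDyer.Theorems.UniversalToricDescentTwinSplit.HowardSplitByA3

end
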